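import Mathlib
import Summits.ValiantsHypothesis.ValiantsHypothesis.Theorems.FifoMatchingNNDivisionHardCofactorComplexityLowerBound
import HarnessLib

/-!
# Route FifoMatching — crux `NNDivisionHard` (stmt-ValiantsHypothesis-21181): PRODUCTS OF POWERS OF SPARSE POLYNOMIALS ARE
# NOT CERTIFICATES — `h = ∏_j q_j^{D_j}` with `Σ_j |supp q_j| ≤ n/(log₂ n)^k`, any degrees, any supports, any interleaving

The Newton dimension is sub-additive under products (`Newt(pq) = Newt p + Newt q`) and invariant under powers
(`Newt(q^D) = D · Newt q`), and at most `|supp q|` for a single factor.  With the dimension tier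
`…PolylogArcFaces.polylogNewtonDim_not_certificate_qp'` (this hand) this decides one more explicit family of cheap, hyper-degree,
torus-homogeneous (when the `q_j` are) cofactors, containing the binomial powers `(a x^P + b x^Q)^D` of `…BinomialPowers` /
`…ArcFaces`, the power sums of `…PowerSums` / `…ManyArcFaces`, and all their PRODUCTS over arbitrary (interleaved, overlapping)
families of matchings:

* `vs_pow_le` (`dir aff supp(q^D) ≤ dir aff supp q`), `finrank_vs_le_card_support`, `finrank_vs_prod_pow_le`
  (`dim Newt(∏_{j<J} q_j^{D_j}) ≤ Σ_{j<J} |supp q_j|`);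
* ★★ `prodPow_not_certificate_qp` — **for every `c` there are `k, n₀`: for all `n ≥ n₀`, all `J`, `q : ℕ → ℝ≥0[arcs]`,
  `D : ℕ → ℕ` with `∏_{j<J} q_j^{D_j} ≠ 0` and `(Σ_{j<J} |supp q_j| + 1)(log₂ n)^k ≤ n`:
  `2^((log₂ n + c)^c) < L₊(NN_n · ∏_j q_j^{D_j}) + L₊(∏_j q_j^{D_j})`.**

HONEST FRAMING: an explicit family for ONE crux; stmt-21181 stays OPEN; nothing here bears on `NNNotVP` or on VP ≠ VNP (NOT
proved).  No definitions, no named facts.  References: Hrubeš–Yehudayoff 2021 §6 Problem 2 [HrubesYehudayoff2021].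
-/

noncomputable section

-- Sub = Summit single-conjunct layout: the duplicated namespace component is mandated by the tree.
set_option linter.dupNamespace false
set_option autoImplicit false

namespace Summit.ValiantsHypothesis.ValiantsHypothesis.Theorems.FifoMatching.NNDivisionHard.ProductCofactors

open Finset MvPolynomial Literature.Computability.AlgebraicComplexity
open Summit.ValiantsHypothesis.ValiantsHypothesis.Theorems.FifoMatching.NNDivisionHard.CofactorComplexityLowerBound
  (vs_mul_le vs_le_of_subsingleton)
open Summit.ValiantsHypothesis.ValiantsHypothesis.Theorems.FifoMatching.NNDivisionHard.PolylogArcFaces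
  (polylogNewtonDim_not_certificate_qp')
open scoped NNReal BigOperators

/-! ### §1 Newton dimension of powers and products -/

section Dim

variable {σ : Type*}

/-- `Newt(q^D) = D · Newt(q)`: powers add no direction. [folklore] -/
theorem vs_pow_le (q : MvPolynomial σ ℝ≥0) (D : ℕ) :
    vectorSpan ℚ ((fun u : σ →₀ ℕ => fun a : σ => (u a : ℚ)) '' ((q ^ D).support : Set (σ →₀ ℕ))) ≤
      vectorSpan ℚ ((fun u : σ →₀ ℕ => fun a : σ => (u a : ℚ)) '' (q.support : Set (σ →₀ ℕ))) := by
  classical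
  induction D with
  | zero =>
    rw [pow_zero]
    exact vs_le_of_subsingleton (d := 0) (by rw [← C_1]; exact support_monomial_subset) _
  | succ D ih =>
    rw [pow_succ]
    exact (vs_mul_le _ _).trans (sup_le ih le_rfl)

/-- `dim Newt(q) ≤ |supp q|`. [folklore] -/
theorem finrank_vs_le_card_support [Fintype σ] (q : MvPolynomial σ ℝ≥0) :
    Module.finrank ℚ (vectorSpan ℚ ((fun u : σ →₀ ℕ => fun a : σ => (u a : ℚ)) '' (q.support : Set (σ →₀ ℕ)))) ≤
      q.support.card := by
  classical
  rw [← Finset.coe_image]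
  by_cases h0 : q.support = ∅
  · rw [h0, Finset.image_empty, Finset.coe_empty, vectorSpan_empty, finrank_bot]
    exact Nat.zero_le _
  · have hpos : 0 < q.support.card := Finset.card_pos.2 (Finset.nonempty_iff_ne_empty.2 h0)
    exact (finrank_vectorSpan_image_finset_le ℚ _ q.support (by omega : q.support.card = (q.support.card - 1) + 1)).trans
      (Nat.sub_le _ _)

/-- ★ `dim Newt(∏_{j<J} q_j^{D_j}) ≤ Σ_{j<J} |supp q_j|`. [folklore] -/
theorem finrank_vs_prod_pow_le [Fintype σ] (q : ℕ → MvPolynomial σ ℝ≥0) (D : ℕ → ℕ) (J : ℕ) :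
    Module.finrank ℚ (vectorSpan ℚ ((fun u : σ →₀ ℕ => fun a : σ => (u a : ℚ)) ''
      ((∏ j ∈ Finset.range J, q j ^ D j).support : Set (σ →₀ ℕ)))) ≤ ∑ j ∈ Finset.range J, (q j).support.card := by
  classical
  induction J with
  | zero =>
    rw [Finset.prod_range_zero, Finset.sum_range_zero]
    have : vectorSpan ℚ ((fun u : σ →₀ ℕ => fun a : σ => (u a : ℚ)) ''
        ((1 : MvPolynomial σ ℝ≥0).support : Set (σ →₀ ℕ))) ≤ ⊥ :=
      vs_le_of_subsingleton (d := 0) (by rw [← C_1]; exact support_monomial_subset) _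
    rw [le_bot_iff.1 this, finrank_bot]
  | succ J ih =>
    rw [Finset.prod_range_succ, Finset.sum_range_succ]
    calc Module.finrank ℚ (vectorSpan ℚ ((fun u : σ →₀ ℕ => fun a : σ => (u a : ℚ)) ''
          (((∏ j ∈ Finset.range J, q j ^ D j) * q J ^ D J).support : Set (σ →₀ ℕ))))
        ≤ Module.finrank ℚ ↥(vectorSpan ℚ ((fun u : σ →₀ ℕ => fun a : σ => (u a : ℚ)) ''
              ((∏ j ∈ Finset.range J, q j ^ D j).support : Set (σ →₀ ℕ))) ⊔
            vectorSpan ℚ ((fun u : σ →₀ ℕ => fun a : σ => (u a : ℚ)) '' ((q J).support : Set (σ →₀ ℕ)))) :=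
          Submodule.finrank_mono ((vs_mul_le _ _).trans (sup_le_sup_left (vs_pow_le _ _) _))
      _ ≤ _ := Submodule.finrank_add_le_finrank_add_finrank _ _
      _ ≤ (∑ j ∈ Finset.range J, (q j).support.card) + (q J).support.card :=
          Nat.add_le_add ih (finrank_vs_le_card_support _)

end Dim

/-! ### §2 Products of powers of sparse polynomials are not certificates -/

/-- ★★ **PRODUCTS OF POWERS OF SPARSE POLYNOMIALS ARE NOT CERTIFICATES.**  For every `c` there are `k, n₀` with: for all
`n ≥ n₀`, `J`, `q`, `D` with `∏_{j<J} q_j^{D_j} ≠ 0` and `(Σ_{j<J} |supp q_j| + 1)(log₂ n)^k ≤ n`,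
`2^((log₂ n + c)^c) < L₊(NN_n · ∏_{j<J} q_j^{D_j}) + L₊(∏_{j<J} q_j^{D_j})`. [cite: HrubesYehudayoff2021, §6 Problem 2] -/
theorem prodPow_not_certificate_qp (c : ℕ) : ∃ k n₀ : ℕ, ∀ n : ℕ, n₀ ≤ n →
    ∀ (J : ℕ) (q : ℕ → MvPolynomial (Fin (2 * n) × Fin (2 * n)) ℝ≥0) (D : ℕ → ℕ),
      (∏ j ∈ Finset.range J, q j ^ D j) ≠ 0 →
      ((∑ j ∈ Finset.range J, (q j).support.card) + 1) * (Nat.log 2 n) ^ k ≤ n →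
      2 ^ ((Nat.log 2 n + c) ^ c) <
        complexity (nestFreeMatchingPoly n ℝ≥0 * ∏ j ∈ Finset.range J, q j ^ D j) +
          complexity (∏ j ∈ Finset.range J, q j ^ D j) := by
  obtain ⟨k, n₀, hk⟩ := polylogNewtonDim_not_certificate_qp' c
  refine ⟨k, n₀, fun n hn J q D hh hS => hk n hn _ hh (le_trans (Nat.mul_le_mul_right _ ?_) hS)⟩
  exact Nat.add_le_add_right (finrank_vs_prod_pow_le q D J) 1

end Summit.ValiantsHypothesis.ValiantsHypothesis.Theorems.FifoMatching.NNDivisionHard.ProductCofactors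

end
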